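import Mathlib
import HarnessLib

/-!
# The Gilmore–Hoffman theorem, comparability half (Golumbic, Prop. 1.3 and Thm. 8.1 (i) ⟹ (ii) ⟹ (iii))

Topic `Literature/Combinatorics/SimpleGraph`.  Twenty-fifth file of the chordal series, sequel of
`IntervalGraphChordal` (interval graphs are chordal, [Golumbic, Prop. 1.2]) and
`IntervalGraphConsecutiveCliques` ([Golumbic, Thm. 8.1 (i) ⟺ (iii)]).
[Golumbic, *Algorithmic Graph Theory and Perfect Graphs*, Thm. 8.1 (Gilmore–Hoffman 1964)]: for an
undirected graph `G` the following are equivalent — (i) `G` is an interval graph; (ii) `G` contains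
no chordless 4-cycle and its complement `Ḡ` is a comparability graph (admits a TRANSITIVE
ORIENTATION `F`: `F ∩ F⁻¹ = ∅`, `F ∪ F⁻¹ = E(Ḡ)`, `F² ⊆ F`); (iii) the maximal cliques of `G` can be
linearly ordered so that, for every vertex `x`, the maximal cliques containing `x` occur
consecutively.  This file proves (i) ⟹ (ii) (for any interval representation over a linear order:
every 4-cycle has a chord, and "`I_u` lies entirely to the left of `I_v`" is a transitive
orientation of the complement — [Golumbic, Prop. 1.3 (Ghouila-Houri 1962)]) and the heart of the
theorem, (ii) ⟹ (iii), for finite graphs [Golumbic, Thm. 8.1, Lemma A]: for distinct maximal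
cliques `A₁, A₂` some non-edge joins them, all such non-edges are oriented the same way by `F`
(else a chordless 4-cycle or a violation of transitivity appears), and "`A₁ < A₂` iff `F` points
from `A₁` to `A₂`" is then a strict linear order on the maximal cliques in which the cliques
containing any fixed vertex are consecutive.  With `IntervalGraphConsecutiveCliques` ((iii) ⟹ (i))
this closes the cycle (i) ⟹ (ii) ⟹ (iii) ⟹ (i).

A transitive orientation of the complement is encoded by a relation `F : V → V → Prop` with
`F u v → u ≠ v ∧ ¬ G.Adj u v` (`F ⊆ E(Ḡ)`), `u ≠ v → ¬ G.Adj u v → F u v ∨ F v u`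
(`F ∪ F⁻¹ = E(Ḡ)`) and `F u v → F v w → F u w` (`F² ⊆ F`; asymmetry follows).  "No chordless
4-cycle" is `a ≠ c → b ≠ d → a ∼ b → b ∼ c → c ∼ d → d ∼ a → a ∼ c ∨ b ∼ d`.

## Contents

* `adj_or_adj_of_cycle_four_of_intervalRepresentation` — (i) ⟹ (ii), first half: in an
  intersection graph of intervals every 4-cycle has a chord [Golumbic, Thm. 8.1 ((i) ⟹ (ii))].
* `exists_transitiveOrientation_of_intervalRepresentation` — (i) ⟹ (ii), second half: the
  complement of an interval graph is transitively orientable [Golumbic, Prop. 1.3].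
* **`exists_consecutive_maximalCliques_of_transitiveOrientation`** — (ii) ⟹ (iii)
  [Golumbic, Thm. 8.1 ((ii) ⟹ (iii)), Lemma A].

## References

* [Golumbic1980] M. C. Golumbic, *Algorithmic Graph Theory and Perfect Graphs*, Academic Press
  (1980); 2nd ed., Ann. Discrete Math. 57 (2004), §1.3 Prop. 1.2, Prop. 1.3, Thm. 1.4; §8.2
  Thm. 8.1 with Lemma A.  Read: galaxy `panama:327388177104967`, pdf pp. 25–26 and 141–142.
* P. C. Gilmore, A. J. Hoffman, *A characterization of comparability graphs and of interval
  graphs*, Canad. J. Math. 16 (1964) 539–548; A. Ghouila-Houri, C. R. Acad. Sci. Paris 254 (1962)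
  1370–1371 (attribution only).
-/

namespace Literature.Combinatorics.SimpleGraph

open _root_.SimpleGraph

variable {V : Type*} {G : _root_.SimpleGraph V}

/-! ### (i) ⟹ (ii) -/

/-- `[a₁, b₁] ∩ [a₂, b₂] ≠ ∅ ⟺ max a₁ a₂ ≤ min b₁ b₂`. [folklore] -/
private theorem icc_inter_icc_nonempty_iff' {α : Type*} [LinearOrder α] {a₁ b₁ a₂ b₂ : α} :
    (Set.Icc a₁ b₁ ∩ Set.Icc a₂ b₂).Nonempty ↔ max a₁ a₂ ≤ min b₁ b₂ := by
  rw [Set.Icc_inter_Icc, Set.nonempty_Icc]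

/-- **(i) ⟹ (ii), first half: an intersection graph of intervals has no chordless 4-cycle**
(indeed it is chordal, `IntervalGraphChordal.isChordal_of_intervalRepresentation`): if
`u ∼ v ⟺ u ≠ v ∧ [a u, b u] ∩ [a v, b v] ≠ ∅` for nonempty closed intervals over a linear order,
then every 4-cycle `x ∼ y ∼ z ∼ w ∼ x` (`x ≠ z`, `y ≠ w`) has a chord `x ∼ z` or `y ∼ w`.
[cite: Golumbic1980, Thm. 8.1 ((i) ⟹ (ii))] -/
theorem adj_or_adj_of_cycle_four_of_intervalRepresentation {α : Type*} [LinearOrder α]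
    (a b : V → α) (hab : ∀ v, a v ≤ b v)
    (hadj : ∀ u v, G.Adj u v ↔ u ≠ v ∧ (Set.Icc (a u) (b u) ∩ Set.Icc (a v) (b v)).Nonempty)
    {x y z w : V} (hxz : x ≠ z) (hyw : y ≠ w) (hxy : G.Adj x y) (hyz : G.Adj y z)
    (hzw : G.Adj z w) (hwx : G.Adj w x) : G.Adj x z ∨ G.Adj y w := by
  by_contra hcon
  push Not at hcon
  obtain ⟨hxz', hyw'⟩ := hcon
  have meet : ∀ {u v}, G.Adj u v → max (a u) (a v) ≤ min (b u) (b v) := fun h =>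
    icc_inter_icc_nonempty_iff'.1 ((hadj _ _).1 h).2
  have apart : ∀ {u v}, u ≠ v → ¬ G.Adj u v → b u < a v ∨ b v < a u := by
    intro u v hne h
    have h' : ¬ max (a u) (a v) ≤ min (b u) (b v) := fun hle =>
      h ((hadj u v).2 ⟨hne, icc_inter_icc_nonempty_iff'.2 hle⟩)
    rw [not_le, lt_max_iff, min_lt_iff, min_lt_iff] at h'
    rcases h' with (h' | h') | (h' | h')
    · exact absurd (hab u) (not_le.2 h')
    · exact Or.inr h'
    · exact Or.inl h'
    · exact absurd (hab v) (not_le.2 h')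
  have hxy' := meet hxy
  have hyz' := meet hyz
  have hzw' := meet hzw
  have hwx' := meet hwx
  simp only [max_le_iff, le_min_iff] at hxy' hyz' hzw' hwx'
  -- `y` and `w` both meet `x` and `z`; when `x, z` are apart and `y, w` are apart, a cycle of
  -- strict inequalities closes up.
  rcases apart hxz hxz' with h | h <;> rcases apart hyw hyw' with h' | h'
  · exact lt_irrefl (a w) (calc a w ≤ b x := hwx'.2.1
      _ < a z := h
      _ ≤ b y := hyz'.1.2
      _ < a w := h')
  · exact lt_irrefl (a y) (calc a y ≤ b x := hxy'.1.2
      _ < a z := h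
      _ ≤ b w := hzw'.2.1
      _ < a y := h')
  · exact lt_irrefl (a w) (calc a w ≤ b z := hzw'.1.2
      _ < a x := h
      _ ≤ b y := hxy'.2.1
      _ < a w := h')
  · exact lt_irrefl (a y) (calc a y ≤ b z := hyz'.2.1
      _ < a x := h
      _ ≤ b w := hwx'.1.2
      _ < a y := h')

/-- **(i) ⟹ (ii), second half: the complement of an interval graph is transitively orientable**
(Ghouila-Houri): orienting each non-edge `uv` from the interval lying entirely to the left to the
one on the right, `F u v :⟺ b u < a v`, gives `F ∪ F⁻¹ = E(Ḡ)`, `F ⊆ E(Ḡ)` and `F² ⊆ F`.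
[cite: Golumbic1980, Prop. 1.3] -/
theorem exists_transitiveOrientation_of_intervalRepresentation {α : Type*} [LinearOrder α]
    (a b : V → α) (hab : ∀ v, a v ≤ b v)
    (hadj : ∀ u v, G.Adj u v ↔ u ≠ v ∧ (Set.Icc (a u) (b u) ∩ Set.Icc (a v) (b v)).Nonempty) :
    ∃ F : V → V → Prop, (∀ u v, u ≠ v → ¬ G.Adj u v → F u v ∨ F v u) ∧
      (∀ u v, F u v → u ≠ v ∧ ¬ G.Adj u v) ∧ ∀ u v w, F u v → F v w → F u w := by
  refine ⟨fun u v => b u < a v, fun u v hne h => ?_, fun u v h => ?_, fun u v w huv hvw => ?_⟩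
  · have h' : ¬ max (a u) (a v) ≤ min (b u) (b v) := fun hle =>
      h ((hadj u v).2 ⟨hne, icc_inter_icc_nonempty_iff'.2 hle⟩)
    rw [not_le, lt_max_iff, min_lt_iff, min_lt_iff] at h'
    rcases h' with (h' | h') | (h' | h')
    · exact absurd (hab u) (not_le.2 h')
    · exact Or.inr h'
    · exact Or.inl h'
    · exact absurd (hab v) (not_le.2 h')
  · have hsep : ¬ max (a u) (a v) ≤ min (b u) (b v) := fun hle =>
      lt_irrefl (b u) (calc b u < a v := h
        _ ≤ max (a u) (a v) := le_max_right _ _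
        _ ≤ min (b u) (b v) := hle
        _ ≤ b u := min_le_left _ _)
    refine ⟨fun huv => ?_, fun hA => hsep (icc_inter_icc_nonempty_iff'.1 ((hadj u v).1 hA).2)⟩
    subst huv
    exact lt_irrefl (b u) (lt_of_lt_of_le h (hab u))
  · exact lt_of_lt_of_le huv ((hab v).trans (le_of_lt hvw))

/-! ### (ii) ⟹ (iii) -/

section Orientation

variable {F : V → V → Prop}

/-- `F` is irreflexive. [folklore] -/
private theorem orient_irrefl (hFE : ∀ u v, F u v → u ≠ v ∧ ¬ G.Adj u v) (u : V) : ¬ F u u :=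
  fun h => (hFE u u h).1 rfl

/-- `F` is asymmetric (`F ∩ F⁻¹ = ∅` follows from `F² ⊆ F` and irreflexivity). [folklore] -/
private theorem orient_asymm (hFE : ∀ u v, F u v → u ≠ v ∧ ¬ G.Adj u v)
    (hFtr : ∀ u v w, F u v → F v w → F u w) {u v : V} (h : F u v) : ¬ F v u :=
  fun h' => orient_irrefl (G := G) hFE u (hFtr u v u h h')

/-- A vertex adjacent to every other vertex of a maximal clique belongs to it. [folklore] -/
private theorem mem_of_forall_adj' {K : Set V} (hK : Maximal G.IsClique K) {v : V}
    (hv : ∀ u ∈ K, u ≠ v → G.Adj u v) : v ∈ K := by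
  have hins : G.IsClique (insert v K) := by
    intro x hx y hy hxy
    rcases hx with rfl | hx <;> rcases hy with rfl | hy
    · exact absurd rfl hxy
    · exact (hv y hy (Ne.symm hxy)).symm
    · exact hv x hx hxy
    · exact hK.1 hx hy hxy
  exact hK.2 hins (Set.subset_insert v K) (Set.mem_insert v K)

/-- **Lemma A (first part): distinct maximal cliques are joined by a non-edge**, hence by an
`F`-arc in one of the two directions. [cite: Golumbic1980, Thm. 8.1 (Lemma A)] -/
private theorem exists_orient_of_ne (hF : ∀ u v, u ≠ v → ¬ G.Adj u v → F u v ∨ F v u)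
    {A B : Set V} (hA : Maximal G.IsClique A) (hB : Maximal G.IsClique B) (hne : A ≠ B) :
    (∃ x ∈ A, ∃ y ∈ B, F x y) ∨ ∃ y ∈ B, ∃ x ∈ A, F y x := by
  by_contra hcon
  push Not at hcon
  obtain ⟨h₁, h₂⟩ := hcon
  have hcross : ∀ x ∈ A, ∀ y ∈ B, x ≠ y → G.Adj x y := by
    intro x hx y hy hxy
    by_contra hxy'
    rcases hF x y hxy hxy' with h | h
    · exact h₁ x hx y hy h
    · exact h₂ y hy x hx h
  have hU : G.IsClique (A ∪ B) := by
    intro x hx y hy hxy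
    rcases hx with hx | hx <;> rcases hy with hy | hy
    · exact hA.1 hx hy hxy
    · exact hcross x hx y hy hxy
    · exact (hcross y hy x hx (Ne.symm hxy)).symm
    · exact hB.1 hx hy hxy
  have hBA : B ⊆ A := fun y hy => (hA.2 hU Set.subset_union_left) (Set.mem_union_right A hy)
  have hAB : A ⊆ B := fun x hx => (hB.2 hU Set.subset_union_right) (Set.mem_union_left B hx)
  exact hne (Set.Subset.antisymm hAB hBA)

/-- **Lemma A (second part): all non-edges between two cliques are oriented the same way** —
arcs `a → b` and `d → c` with `a, c ∈ A`, `b, d ∈ B` cannot coexist (transitivity of `F`, or a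
chordless 4-cycle `a d b c`). [cite: Golumbic1980, Thm. 8.1 (Lemma A)] -/
private theorem orient_uniform
    (h4 : ∀ a b c d, a ≠ c → b ≠ d → G.Adj a b → G.Adj b c → G.Adj c d → G.Adj d a →
      G.Adj a c ∨ G.Adj b d)
    (hF : ∀ u v, u ≠ v → ¬ G.Adj u v → F u v ∨ F v u)
    (hFE : ∀ u v, F u v → u ≠ v ∧ ¬ G.Adj u v) (hFtr : ∀ u v w, F u v → F v w → F u w)
    {A B : Set V} (hA : G.IsClique A) (hB : G.IsClique B) {a c b d : V} (ha : a ∈ A) (hc : c ∈ A)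
    (hb : b ∈ B) (hd : d ∈ B) (hab : F a b) (hdc : F d c) : False := by
  have hab' := hFE _ _ hab
  have hdc' := hFE _ _ hdc
  by_cases hac : a = c
  · subst hac
    have hdb := hFE _ _ (hFtr d a b hdc hab)
    rcases eq_or_ne d b with rfl | hne
    · exact hdb.1 rfl
    · exact hdb.2 (hB hd hb hne)
  by_cases hbd : b = d
  · subst hbd
    exact (hFE _ _ (hFtr a b c hab hdc)).2 (hA ha hc hac)
  have hAC : G.Adj a c := hA ha hc hac
  have hBD : G.Adj b d := hB hb hd hbd
  by_cases had : G.Adj a d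
  · by_cases hbc : G.Adj b c
    · -- the 4-cycle `a d b c` would be chordless
      rcases h4 a d b c hab'.1 hdc'.1 had hBD.symm hbc hAC.symm with h | h
      · exact hab'.2 h
      · exact hdc'.2 h
    · rcases eq_or_ne b c with rfl | hbc'
      · exact hab'.2 hAC
      rcases hF b c hbc' hbc with h | h
      · exact (hFE _ _ (hFtr a b c hab h)).2 hAC
      · exact (hFE _ _ (hFtr d c b hdc h)).2 hBD.symm
  · rcases eq_or_ne a d with rfl | had'
    · exact hdc'.2 hAC
    rcases hF a d had' had with h | h
    · exact (hFE _ _ (hFtr a d c h hdc)).2 hAC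
    · exact (hFE _ _ (hFtr d a b h hab)).2 hBD.symm

variable (h4 : ∀ a b c d, a ≠ c → b ≠ d → G.Adj a b → G.Adj b c → G.Adj c d → G.Adj d a →
    G.Adj a c ∨ G.Adj b d)
  (hF : ∀ u v, u ≠ v → ¬ G.Adj u v → F u v ∨ F v u)
  (hFE : ∀ u v, F u v → u ≠ v ∧ ¬ G.Adj u v) (hFtr : ∀ u v w, F u v → F v w → F u w)
include h4 hF hFE hFtr

/-- If some arc points from `A` to `B`, every non-edge between them points from `A` to `B`.
[cite: Golumbic1980, Thm. 8.1 (Lemma A)] -/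
private theorem orient_of_cliqueLT {A B : Set V} (hA : Maximal G.IsClique A)
    (hB : Maximal G.IsClique B) (hlt : ∃ x ∈ A, ∃ y ∈ B, F x y) {x y : V} (hx : x ∈ A) (hy : y ∈ B)
    (hxy : x ≠ y) (hxy' : ¬ G.Adj x y) : F x y := by
  obtain ⟨a, ha, b, hb, hab⟩ := hlt
  rcases hF x y hxy hxy' with h | h
  · exact h
  · exact (orient_uniform h4 hF hFE hFtr hA.1 hB.1 ha hx hb hy hab h).elim

/-- The clique relation "`F` points from `A` to `B`" is asymmetric. [cite: Golumbic1980, Thm. 8.1] -/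
private theorem cliqueLT_asymm {A B : Set V} (hA : Maximal G.IsClique A) (hB : Maximal G.IsClique B)
    (hAB : ∃ x ∈ A, ∃ y ∈ B, F x y) (hBA : ∃ y ∈ B, ∃ x ∈ A, F y x) : False := by
  obtain ⟨a, ha, b, hb, hab⟩ := hAB
  obtain ⟨d, hd, c, hc, hdc⟩ := hBA
  exact orient_uniform h4 hF hFE hFtr hA.1 hB.1 ha hc hb hd hab hdc

/-- The clique relation is transitive (a chordless 4-cycle is excluded once more).
[cite: Golumbic1980, Thm. 8.1 ((ii) ⟹ (iii))] -/
private theorem cliqueLT_trans {A B C : Set V} (hA : Maximal G.IsClique A)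
    (hB : Maximal G.IsClique B) (hC : Maximal G.IsClique C) (hAB : ∃ x ∈ A, ∃ y ∈ B, F x y)
    (hBC : ∃ y ∈ B, ∃ z ∈ C, F y z) : ∃ x ∈ A, ∃ z ∈ C, F x z := by
  obtain ⟨w, hw, x, hx, hwx⟩ := hAB
  obtain ⟨y, hy, z, hz, hyz⟩ := hBC
  by_cases hxy : x = y
  · subst hxy
    exact ⟨w, hw, z, hz, hFtr _ _ _ hwx hyz⟩
  have hXY : G.Adj x y := hB.1 hx hy hxy
  by_cases hxz : G.Adj x z
  · by_cases hwy : G.Adj w y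
    · by_cases hwz : G.Adj w z
      · -- the 4-cycle `w y x z` would be chordless
        rcases h4 w y x z (hFE _ _ hwx).1 (hFE _ _ hyz).1 hwy hXY.symm hxz hwz.symm with h | h
        · exact ((hFE _ _ hwx).2 h).elim
        · exact ((hFE _ _ hyz).2 h).elim
      · rcases eq_or_ne w z with rfl | hwz'
        · exact ((hFE _ _ hwx).2 hxz.symm).elim
        rcases hF w z hwz' hwz with h | h
        · exact ⟨w, hw, z, hz, h⟩
        · exact ((hFE _ _ (hFtr z w x h hwx)).2 hxz.symm).elim
    · rcases eq_or_ne w y with rfl | hwy'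
      · exact ((hFE _ _ hwx).2 hXY.symm).elim
      have hwy'' : F w y :=
        orient_of_cliqueLT h4 hF hFE hFtr hA hB ⟨w, hw, x, hx, hwx⟩ hw hy hwy' hwy
      exact ⟨w, hw, z, hz, hFtr _ _ _ hwy'' hyz⟩
  · rcases eq_or_ne x z with rfl | hxz'
    · exact ((hFE _ _ hyz).2 hXY.symm).elim
    have hxz'' : F x z := orient_of_cliqueLT h4 hF hFE hFtr hB hC ⟨y, hy, z, hz, hyz⟩ hx hz hxz' hxz
    exact ⟨w, hw, z, hz, hFtr _ _ _ hwx hxz''⟩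

/-- **Consecutiveness**: if `F` points from `A` to `B` and from `B` to `C`, every vertex of
`A ∩ C` lies in `B`. [cite: Golumbic1980, Thm. 8.1 ((ii) ⟹ (iii))] -/
private theorem mem_of_cliqueLT_of_cliqueLT {A B C : Set V} (hA : Maximal G.IsClique A)
    (hB : Maximal G.IsClique B) (hC : Maximal G.IsClique C) (hAB : ∃ x ∈ A, ∃ y ∈ B, F x y)
    (hBC : ∃ y ∈ B, ∃ z ∈ C, F y z) {x : V} (hxA : x ∈ A) (hxC : x ∈ C) : x ∈ B := by
  by_contra hxB
  have hy : ∃ y ∈ B, y ≠ x ∧ ¬ G.Adj y x := by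
    by_contra hcon
    push Not at hcon
    exact hxB (mem_of_forall_adj' hB hcon)
  obtain ⟨y, hy, hyx, hyx'⟩ := hy
  have h₁ : F x y :=
    orient_of_cliqueLT h4 hF hFE hFtr hA hB hAB hxA hy (Ne.symm hyx) fun h => hyx' h.symm
  have h₂ : F y x := orient_of_cliqueLT h4 hF hFE hFtr hB hC hBC hy hxC hyx hyx'
  exact orient_asymm (G := G) hFE hFtr h₁ h₂

/-- **(ii) ⟹ (iii) of the Gilmore–Hoffman theorem** [Golumbic, Thm. 8.1]: if the finite graph
`G` has no chordless 4-cycle and its complement admits a transitive orientation `F`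
(`F ∪ F⁻¹ = E(Ḡ)`, `F ⊆ E(Ḡ)`, `F² ⊆ F`), then the maximal cliques of `G` can be enumerated
without repetition as `β 0, …, β (n-1)` so that the cliques containing any vertex `x` are
consecutive: `x ∈ β i`, `x ∈ β k`, `i ≤ j ≤ k` imply `x ∈ β j`.  The order is "`A < B` iff some
arc of `F` points from `A` to `B`" (a strict linear order by Lemma A).
[cite: Golumbic1980, Thm. 8.1 ((ii) ⟹ (iii))] -/
theorem exists_consecutive_maximalCliques_of_transitiveOrientation [Finite V] :
    ∃ (n : ℕ) (β : Fin n → Set V), Function.Injective β ∧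
      (∀ K, Maximal G.IsClique K ↔ K ∈ Set.range β) ∧
      ∀ x (i j k : Fin n), i ≤ j → j ≤ k → x ∈ β i → x ∈ β k → x ∈ β j := by
  classical
  haveI := Fintype.ofFinite V
  -- the maximal cliques, as a finset of sets
  let M : Finset (Set V) := (Finset.univ : Finset (Set V)).filter fun K => Maximal G.IsClique K
  have hM : ∀ K, K ∈ M ↔ Maximal G.IsClique K := fun K => by simp [M]
  -- the clique relation and its rank function
  let lt : Set V → Set V → Prop := fun A B => ∃ x ∈ A, ∃ y ∈ B, F x y
  have lt_irrefl : ∀ {A}, Maximal G.IsClique A → ¬ lt A A := by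
    rintro A hA ⟨x, hx, y, hy, hxy⟩
    rcases eq_or_ne x y with rfl | hne
    · exact (hFE _ _ hxy).1 rfl
    · exact (hFE _ _ hxy).2 (hA.1 hx hy hne)
  have lt_total : ∀ {A B}, Maximal G.IsClique A → Maximal G.IsClique B → A ≠ B →
      lt A B ∨ lt B A := fun hA hB hne => exists_orient_of_ne hF hA hB hne
  let rank : Set V → ℕ := fun K => (M.filter fun L => lt L K).card
  have rank_lt : ∀ {A B}, Maximal G.IsClique A → Maximal G.IsClique B → lt A B →
      rank A < rank B := by
    intro A B hA hB hAB
    apply Finset.card_lt_card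
    refine ⟨fun L hL => ?_, fun hsub => ?_⟩
    · rw [Finset.mem_filter] at hL ⊢
      exact ⟨hL.1, cliqueLT_trans h4 hF hFE hFtr ((hM L).1 hL.1) hA hB hL.2 hAB⟩
    · have hAmem : A ∈ M.filter fun L => lt L B := Finset.mem_filter.2 ⟨(hM A).2 hA, hAB⟩
      exact lt_irrefl hA (Finset.mem_filter.1 (hsub hAmem)).2
  -- enumerate `M` sorted by rank
  set n := M.card with hn
  let e : Fin n ≃ {K // K ∈ M} := M.equivFin.symm
  let f : Fin n → ℕ := fun i => rank (e i).1
  let σ : Equiv.Perm (Fin n) := Tuple.sort f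
  have hmono : Monotone (f ∘ σ) := Tuple.monotone_sort f
  let β : Fin n → Set V := fun i => (e (σ i)).1
  have hβmax : ∀ i, Maximal G.IsClique (β i) := fun i => (hM _).1 (e (σ i)).2
  have hβinj : Function.Injective β := fun i j hij =>
    σ.injective (e.injective (Subtype.ext hij))
  have hβlt : ∀ {i j : Fin n}, i < j → lt (β i) (β j) := by
    intro i j hij
    have hne : β i ≠ β j := fun h => (ne_of_lt hij) (hβinj h)
    rcases lt_total (hβmax i) (hβmax j) hne with h | h
    · exact h
    · exact absurd (hmono (le_of_lt hij)) (not_le.2 (rank_lt (hβmax j) (hβmax i) h))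
  refine ⟨n, β, hβinj, fun K => ⟨fun hK => ?_, ?_⟩, fun x i j k hij hjk hxi hxk => ?_⟩
  · refine ⟨σ.symm (e.symm ⟨K, (hM K).2 hK⟩), ?_⟩
    simp [β]
  · rintro ⟨i, rfl⟩
    exact hβmax i
  · rcases eq_or_lt_of_le hij with rfl | hij'
    · exact hxi
    rcases eq_or_lt_of_le hjk with rfl | hjk'
    · exact hxk
    exact mem_of_cliqueLT_of_cliqueLT h4 hF hFE hFtr (hβmax i) (hβmax j) (hβmax k) (hβlt hij')
      (hβlt hjk') hxi hxk

end Orientation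

end Literature.Combinatorics.SimpleGraph
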